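import Summits.AtomisticToContinuum.BoseEinsteinCondensation.Theorems.BECThomsonPrincipleFibreConductanceCageDefs
import Summits.AtomisticToContinuum.BoseEinsteinCondensation.Theorems.BECThomsonPrincipleFibreConductanceStubTransport
import Summits.AtomisticToContinuum.BoseEinsteinCondensation.Theorems.BECThomsonPrincipleFibreConductanceStubParsevalShell
import HarnessLib

/-!
# Line `tagged-path-harnack-cage-moments` for crux `BECThomsonPrinciple.FibreConductance`
(stmt-AtomisticToContinuum-9480) — WORKING SKELETON of the gen-1 line lead (reshaped r1)

Vocabulary and the seven stub STATEMENTS live in the landed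
`Theorems/BECThomsonPrincipleFibreConductanceCageDefs.lean` (namespace `…TaggedPathHarnack`), over the
landed base vocabulary `Theorems/BECThomsonPrincipleDefs.lean` (namespace `…ParsevalShellBootstrap`).
Reshape w.r.t. the planner's skeleton `Lines/tagged_path_harnack_cage_moments.lean` (same composition
idea, 7 stubs): `stub_fibreSpine` is DISCHARGED by the landed `stub_transport` (p88851) and
`stub_parsevalShell` (p88803) and leaves the stub list; `stub_betaChannel` is SPLIT into
`stub_flatteningOfMoments : ConditionalDensityMoments → DensityFlatteningCubic` (iterated-primitive
flow; deterministic torus calculus) and `stub_betaHolder : DensityFlatteningCubic → ShellOccupation →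
BetaCorrectorBound` (Hölder 3/2–3 in the bath).

Stubs (7, sorried): `stub_localNumberTail` (open input: quantum Ruelle bound), `stub_shiftHarnack`
(THE LEVER; true on paper, XL Lean), `stub_conditionalDensityMoments` (open: cage/fluidity moments),
`stub_gradientFromHarnack` (L/XL), `stub_flatteningOfMoments` (M/L deterministic),
`stub_betaHolder` (M deterministic), `stub_shellOccupation` (XL, HARDEST, the IR input; lead's).
Composition: `cage_compose stub_transport stub_parsevalShell …` concludes `FibreConductance` by name.
-/

noncomputable section

namespace Summit.AtomisticToContinuum.BoseEinsteinCondensation.Cruxes.FibreConductance.TaggedPathHarnack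

open MeasureTheory
open scoped ENNReal
open Literature.MathematicalPhysics.QuantumManyBody.BoseGas
open Summit.AtomisticToContinuum.BoseEinsteinCondensation.Theses.BECThomsonPrinciple (FibreConductance)
open Summit.AtomisticToContinuum.BoseEinsteinCondensation.Cruxes.FibreConductance.ParsevalShellBootstrap
  (stub_transport stub_parsevalShell)

/-! ## Registered stubs -/

/-- **Stub 1** (L/XL, open input; the quantum ground-state Ruelle bound in exponential-moment
form): see `LocalNumberExpMoments`. -/
theorem stub_localNumberTail : Goal.stub_localNumberTail := by
  sorry

/-- **Stub 2** (THE LEVER — tagged Cameron–Martin tilt of the eigen-relation, Jensen,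
stationarity, numerical-range displacement bound): see `ShiftHarnack`. -/
theorem stub_shiftHarnack : Goal.stub_shiftHarnack := by
  sorry

/-- **Stub 3** (L/XL, open; the cage / fluidity half, flow-free): see `ConditionalDensityMoments`. -/
theorem stub_conditionalDensityMoments : Goal.stub_conditionalDensityMoments := by
  sorry

/-- **Stub 4** (L/XL; two-scale corrector for the oscillating charge from ratio moments):
see `GradientFromHarnack`. -/
theorem stub_gradientFromHarnack : Goal.stub_gradientFromHarnack := by
  sorry

/-- **Stub 5** (M/L, deterministic; the iterated-primitive flow at the Poincaré scale):
see `FlatteningOfMoments`. -/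
theorem stub_flatteningOfMoments : Goal.stub_flatteningOfMoments := by
  sorry

/-- **Stub 6** (M, deterministic; Hölder `3/2–3` in the bath): see `BetaHolder`. -/
theorem stub_betaHolder : Goal.stub_betaHolder := by
  sorry

/-- **Stub 7** (XL, HARDEST; the infrared input at the minimal strength the crux forces):
see `ParsevalShellBootstrap.ShellOccupation`. -/
theorem stub_shellOccupation : Goal.stub_shellOccupation := by
  sorry

/-! ## The composition (proved) -/

/-- **THE SKELETON: the seven stub statements imply the crux `FibreConductance` BY NAME**, through
the landed composition `cage_compose` fed with the landed `stub_transport` and `stub_parsevalShell`. -/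
theorem FibreConductance_of (ℓ : Goal.stub_localNumberTail) (h : Goal.stub_shiftHarnack)
    (c : Goal.stub_conditionalDensityMoments) (g : Goal.stub_gradientFromHarnack)
    (f : Goal.stub_flatteningOfMoments) (b : Goal.stub_betaHolder)
    (s : Goal.stub_shellOccupation) : FibreConductance :=
  cage_compose stub_transport stub_parsevalShell ℓ h c g f b s

/-- The crux from the REGISTERED stubs (by name): what closes stmt-AtomisticToContinuum-9480 once
the `sorry`s are discharged. -/
theorem fibreConductance_of_registered_stubs : FibreConductance :=
  FibreConductance_of stub_localNumberTail stub_shiftHarnack stub_conditionalDensityMoments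
    stub_gradientFromHarnack stub_flatteningOfMoments stub_betaHolder stub_shellOccupation

end Summit.AtomisticToContinuum.BoseEinsteinCondensation.Cruxes.FibreConductance.TaggedPathHarnack

end
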